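import Literature.NumberTheory.EllipticCurves.IsogenyMultiplierXFormulaProofs
import Literature.NumberTheory.EllipticCurves.IsogenyRealPeriodProofs
import Literature.NumberTheory.EllipticCurves.IsogenyComplexUniformizationProofs
import Literature.NumberTheory.EllipticCurves.NeronIsogenyScalingHoldsProofs
import Literature.NumberTheory.EllipticCurves.ComplexTorusAddProofs
import HarnessLib

/-!
# The analytic multiplier of a `ℚ`-isogeny between globally minimal models is an integer
# dividing the degree

`Proofs` file (theorems only: no definition, no named fact, no instance), topic
`NumberTheory/EllipticCurves`. First of three files discharging the named fact
`Literature.NumberTheory.EllipticCurves.dokchitser_padicValInt_minimalDiscriminantInt_eq_of_isogeny_of_not_dvd_degree`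
(Dokchitser–Dokchitser 2015, Thm. 5.1 (1), clause `l ≠ p`;
`IsogenyPotentiallyGoodMinimalDiscriminantProofs.lean`).

* `WeierstrassCurve.Isogeny.natCard_ker_baseChange_eq_degree` — for an isogeny `φ : E → E'` over
  any field `K` and any field `M ⊇ K̄`, **`#ker φ_M = #ker φ = deg φ`**: a point of `E(M)` not
  coming from `E(K̄)` is generic and `φ_M` maps it to an affine point
  (`Isogeny.baseChangeFun_some_of_generic`), so `ker φ_M = ι_*(ker φ)`.
* `WeierstrassCurve.Isogeny.exists_int_multiplier_dvd_degree` — for a `ℚ`-isogeny `φ : W → W'`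
  between GLOBALLY MINIMAL elliptic curves: **the analytic multiplier `k` (`φ_ℂ(u z) = u'(kz)`,
  `kΛ ⊆ Λ'` on the Néron lattices; equivalently `φ^*ω' = ±k ω` on the Néron differentials) is an
  integer dividing `deg φ`**, together with the `x`-coordinate formula `x(φP) = A(x)/B(x)`,
  `A, B ∈ ℚ[X]`, `B` monic, `deg A = deg B + 1`, `lc A = k⁻²`. Ingredients, all proved in the
  tree: the analytic theorem with kernel count (`Isogeny.exists_mul_baseChange_apply_eq`,
  Silverman *AEC* VI.4.1(b): `#ker φ_ℂ = [Λ' : kΛ]`), rationality of the multiplier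
  (`Isogeny.exists_algebraMap_eq_of_baseChange_apply_eq`), the `x`-formula
  (`Isogeny.exists_x_formula_of_baseChange_apply_eq`) and the integrality of the Néron scaling
  (`integral_neronScaling_of_isGloballyMinimal_holds`, the tree's substitute for the Néron
  mapping property, Silverman *ATAEC* IV.5–6) applied to `k` and to `deg φ / k`
  (`(deg φ / k) Λ' ⊆ Λ` because `[Λ' : kΛ] = deg φ`).

References: [SilvermanAEC2009] Thm. VI.4.1(b), III.4, III.6.2; [SilvermanATAEC1994] IV.5.1,
IV.6.1, Cor. IV.9.1; [DokchitserDokchitser2015LocalInvariants] Table 1 (the invariant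
`φ^*ω'/ω`). Declarations sit in Mathlib's `WeierstrassCurve` namespace as deliberate
dot-notation extensions of the tree's `WeierstrassCurve.Isogeny`.
-/

noncomputable section

open scoped Classical
open Polynomial

universe u v

namespace WeierstrassCurve

namespace Isogeny

variable {K : Type u} [Field K] {W W' : WeierstrassCurve K}

section KerBaseChange

variable {M : Type v} [Field M] [Algebra K M] [Algebra (AlgebraicClosure K) M]
  [IsScalarTower K (AlgebraicClosure K) M]

/-- **The kernel of the base change `φ_M` of an isogeny is the image of `ker φ`**: every point of
`E(M)` killed by `φ_M` comes from `E(K̄)` (a generic point is mapped to an affine point by the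
rational representation, `baseChangeFun_some_of_generic`), so `#ker φ_M = #ker φ = deg φ`.
Silverman, *AEC*, III.4: a non-constant isogeny has finite kernel `E[φ] ⊆ E(K̄)` (Cor. III.4.9) and is
given by rational functions, so it is surjective with the same kernel on `M`-points for every
algebraically closed, indeed every, field `M ⊇ K̄`. [cite: SilvermanAEC2009, III.4 Cor. 4.9 and Thm. 4.10(a)] -/
theorem natCard_ker_baseChange_eq_degree (φ : Isogeny W W') :
    Nat.card (φ.baseChange (M := M)).ker = φ.degree := by
  set ι := Affine.Point.map (W' := W) (IsScalarTower.toAlgHom K (AlgebraicClosure K) M) with hι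
  set ι' := Affine.Point.map (W' := W') (IsScalarTower.toAlgHom K (AlgebraicClosure K) M) with hι'
  have hιinj : Function.Injective ι := Affine.Point.map_injective _
  have hι'inj : Function.Injective ι' := Affine.Point.map_injective _
  -- `ι` restricts to a bijection `ker φ → ker φ_M`
  let f : φ.toAddMonoidHom.ker → (φ.baseChange (M := M)).ker := fun P ↦
    ⟨ι P.1, by
      have hP : φ P.1 = 0 := P.2
      rw [AddMonoidHom.mem_ker, hι, φ.baseChange_map]
      change ι' (φ P.1) = 0
      rw [hP]; exact map_zero ι'⟩
  have hf : Function.Bijective f := by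
    constructor
    · intro P Q h
      exact Subtype.ext (hιinj (congrArg Subtype.val h))
    · rintro ⟨Q, hQ⟩
      rw [AddMonoidHom.mem_ker] at hQ
      by_cases hmem : Q ∈ Set.range ι
      · obtain ⟨P, rfl⟩ := hmem
        refine ⟨⟨P, ?_⟩, rfl⟩
        rw [AddMonoidHom.mem_ker]
        rw [hι, φ.baseChange_map] at hQ
        have : ι' (φ P) = ι' 0 := by rw [hQ, map_zero]
        exact hι'inj this
      · exfalso
        rcases Q with _ | ⟨x, y, hxy⟩
        · exact hmem ⟨0, map_zero ι⟩
        · rw [φ.baseChange_apply, φ.baseChangeFun_some_of_generic hxy hmem] at hQ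
          exact Affine.Point.some_ne_zero _ hQ
  unfold Isogeny.degree
  exact (Nat.card_eq_of_bijective f hf).symm

end KerBaseChange

end Isogeny

/-! ## The analytic multiplier of a `ℚ`-isogeny between globally minimal models divides the degree -/

section Multiplier

variable [Algebra (AlgebraicClosure ℚ) ℂ] [IsScalarTower ℚ (AlgebraicClosure ℚ) ℂ]

open PeriodPair Literature.NumberTheory.EllipticCurves Complex in
/-- **The multiplier of a `ℚ`-isogeny between globally minimal models is an integer dividing the
degree, and it is read off the `x`-coordinate.** For an isogeny `φ : W → W'` over `ℚ` between
globally minimal elliptic curves there are an integer `k ≠ 0` with `k ∣ deg φ` and polynomials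
`A, B ∈ ℚ[X]`, `B` monic, `deg A = deg B + 1`, `lc A = k⁻²`, with `x(φ P) = A(x)/B(x)` for every
affine `P ∈ W(ℚ̄)` off `ker φ`. Here `k` is the analytic multiplier (`φ_ℂ(u z) = u'(k z)`,
`kΛ ⊆ Λ'` for the Néron lattices, Silverman *AEC* VI.4.1(b)): `k ∈ ℤ` by the integrality of the
Néron scaling (`integral_neronScaling_of_isGloballyMinimal_holds`), `[Λ' : kΛ] = #ker φ_ℂ = deg φ`
(`Isogeny.exists_mul_baseChange_apply_eq`, `natCard_ker_baseChange_eq_degree`), so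
`(deg φ/k)Λ' ⊆ Λ` and `deg φ / k ∈ ℤ` by the same integrality.
[cite: SilvermanAEC2009, Thm. VI.4.1(b)] [cite: SilvermanATAEC1994, IV.5.1 with IV.6.1 and Cor. IV.9.1] -/
theorem Isogeny.exists_int_multiplier_dvd_degree_aux {W W' : WeierstrassCurve ℚ} [W.IsElliptic]
    [W'.IsElliptic] [W.IsGloballyMinimal] [W'.IsGloballyMinimal] (φ : Isogeny W W') :
    ∃ k : ℤ, k ≠ 0 ∧ k ∣ (φ.degree : ℤ) ∧
      ∃ A B : ℚ[X], B.Monic ∧ A.natDegree = B.natDegree + 1 ∧ A.leadingCoeff = (k : ℚ)⁻¹ ^ 2 ∧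
        ∀ (x y : AlgebraicClosure ℚ)
          (h : (W.baseChange (AlgebraicClosure ℚ)).toAffine.Nonsingular x y),
          φ (Affine.Point.some x y h) ≠ 0 →
          aeval x B ≠ 0 ∧ ∃ (y₂ : AlgebraicClosure ℚ)
            (h₂ : (W'.baseChange (AlgebraicClosure ℚ)).toAffine.Nonsingular (aeval x A / aeval x B) y₂),
            φ (Affine.Point.some x y h) = Affine.Point.some (aeval x A / aeval x B) y₂ h₂ := by
  haveI hWℝ : (W.baseChange ℝ).IsElliptic := by rw [WeierstrassCurve.baseChange]; infer_instance
  haveI hWℝ' : (W'.baseChange ℝ).IsElliptic := by rw [WeierstrassCurve.baseChange]; infer_instance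
  -- Néron-type period pairs and uniformisations
  have hc₄ : (((W.baseChange ℝ).c₄ : ℝ) : ℂ) = (W.baseChange ℂ).c₄ := by
    rw [WeierstrassCurve.baseChange, WeierstrassCurve.baseChange, map_c₄, map_c₄,
      ofReal_algebraMap_eq]
  have hc₆ : (((W.baseChange ℝ).c₆ : ℝ) : ℂ) = (W.baseChange ℂ).c₆ := by
    rw [WeierstrassCurve.baseChange, WeierstrassCurve.baseChange, map_c₆, map_c₆,
      ofReal_algebraMap_eq]
  have hc₄' : (((W'.baseChange ℝ).c₄ : ℝ) : ℂ) = (W'.baseChange ℂ).c₄ := by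
    rw [WeierstrassCurve.baseChange, WeierstrassCurve.baseChange, map_c₄, map_c₄,
      ofReal_algebraMap_eq]
  have hc₆' : (((W'.baseChange ℝ).c₆ : ℝ) : ℂ) = (W'.baseChange ℂ).c₆ := by
    rw [WeierstrassCurve.baseChange, WeierstrassCurve.baseChange, map_c₆, map_c₆,
      ofReal_algebraMap_eq]
  obtain ⟨L, hL₂, hL₃, -⟩ := (W.baseChange ℝ).exists_periodPair_realPeriod_eq_holds
  obtain ⟨L', hL₂', hL₃', -⟩ := (W'.baseChange ℝ).exists_periodPair_realPeriod_eq_holds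
  have h₂ : L.g₂ = (W.baseChange ℂ).c₄ / 12 := by rw [hL₂, ← hc₄]; push_cast; ring
  have h₃ : L.g₃ = (W.baseChange ℂ).c₆ / 216 := by rw [hL₃, ← hc₆]; push_cast; ring
  have h₂' : L'.g₂ = (W'.baseChange ℂ).c₄ / 12 := by rw [hL₂', ← hc₄']; push_cast; ring
  have h₃' : L'.g₃ = (W'.baseChange ℂ).c₆ / 216 := by rw [hL₃', ← hc₆']; push_cast; ring
  obtain ⟨u, hkeru, hsurj, hu⟩ := L.exists_addMonoidHom_of_g₂_g₃' h₂ h₃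
  obtain ⟨u', hkeru', hsurj', hu'⟩ := L'.exists_addMonoidHom_of_g₂_g₃' h₂' h₃'
  -- the analytic multiplier `α`, rational: `α = k`
  obtain ⟨α, hα0, hαΛ, happ, hcard⟩ :=
    φ.exists_mul_baseChange_apply_eq h₂ h₃ h₂' h₃' u hkeru hu u' hkeru' hu'
  obtain ⟨k, hk⟩ := φ.exists_algebraMap_eq_of_baseChange_apply_eq h₂ h₃ h₂' h₃' u hkeru hu
    u' hkeru' hu' happ
  have hkC : (k : ℂ) = α := by rw [← hk, eq_ratCast]
  have hk0 : k ≠ 0 := by rintro rfl; exact hα0 (by rw [← hkC, Rat.cast_zero])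
  have hle : ∀ z ∈ L.lattice, algebraMap ℚ ℂ k * z ∈ L'.lattice := fun z hz ↦ by
    rw [hk]; exact hαΛ z hz
  have happk : ∀ z, φ.baseChange (u z) = u' (algebraMap ℚ ℂ k * z) := fun z ↦ by
    rw [hk]; exact happ z
  -- `k ∈ ℤ`
  have hle' : ∀ z ∈ L.lattice, (k : ℂ) * z ∈ L'.lattice := fun z hz ↦ by
    rw [hkC]; exact hαΛ z hz
  obtain ⟨n, hn⟩ := integral_neronScaling_of_isGloballyMinimal_holds W W' L L' ⟨h₂, h₃⟩ ⟨h₂', h₃'⟩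
    k hle'
  -- `[Λ' : kΛ] = deg φ`, so `(deg φ / k) Λ' ⊆ Λ` and `deg φ / k ∈ ℤ`
  have hindex : (L.mulLeft α hα0).lattice.toAddSubgroup.relIndex L'.lattice.toAddSubgroup =
      φ.degree := by
    rw [← hcard, Isogeny.natCard_ker_baseChange_eq_degree]
  have hle'' : ∀ z ∈ L'.lattice, (((φ.degree : ℚ) / k : ℚ) : ℂ) * z ∈ L.lattice := by
    intro z hz
    have hmem : (φ.degree : ℕ) • z ∈ (L.mulLeft α hα0).lattice.toAddSubgroup := by
      rw [← hindex]
      exact AddSubgroup.nsmul_relIndex_mem _ (K := L'.lattice.toAddSubgroup) hz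
    have hmem' : α⁻¹ * ((φ.degree : ℕ) • z) ∈ L.lattice :=
      PeriodPair.mem_mulLeft_lattice.mp hmem
    have hαk : α = (k : ℂ) := hkC.symm
    rw [hαk, nsmul_eq_mul] at hmem'
    have : (((φ.degree : ℚ) / k : ℚ) : ℂ) * z = (k : ℂ)⁻¹ * ((φ.degree : ℂ) * z) := by
      push_cast; ring
    rw [this]
    exact hmem'
  obtain ⟨m, hm⟩ := integral_neronScaling_of_isGloballyMinimal_holds W' W L' L ⟨h₂', h₃'⟩ ⟨h₂, h₃⟩
    ((φ.degree : ℚ) / k) hle''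
  -- the `x`-formula
  obtain ⟨A, B, hBm, hdegAB, hlc, hform⟩ :=
    φ.exists_x_formula_of_baseChange_apply_eq h₂ h₃ h₂' h₃' hsurj hu hkeru' hu' hk0 hle happk
  refine ⟨n, ?_, ?_, A, B, hBm, hdegAB, by rw [hn]; exact hlc, hform⟩
  · rintro rfl; exact hk0 (by rw [← hn, Int.cast_zero])
  · refine ⟨m, ?_⟩
    have h1 : (n : ℚ) * m = φ.degree := by
      rw [hm, hn]; field_simp
    exact_mod_cast h1.symm

end Multiplier

/-- **Instance-free form of `Isogeny.exists_int_multiplier_dvd_degree_aux`** (any embedding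
`ℚ̄ → ℂ`). [cite: SilvermanAEC2009, Thm. VI.4.1(b)] -/
theorem Isogeny.exists_int_multiplier_dvd_degree {W W' : WeierstrassCurve ℚ} [W.IsElliptic]
    [W'.IsElliptic] [W.IsGloballyMinimal] [W'.IsGloballyMinimal] (φ : Isogeny W W') :
    ∃ k : ℤ, k ≠ 0 ∧ k ∣ (φ.degree : ℤ) ∧
      ∃ A B : ℚ[X], B.Monic ∧ A.natDegree = B.natDegree + 1 ∧ A.leadingCoeff = (k : ℚ)⁻¹ ^ 2 ∧
        ∀ (x y : AlgebraicClosure ℚ)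
          (h : (W.baseChange (AlgebraicClosure ℚ)).toAffine.Nonsingular x y),
          φ (Affine.Point.some x y h) ≠ 0 →
          aeval x B ≠ 0 ∧ ∃ (y₂ : AlgebraicClosure ℚ)
            (h₂ : (W'.baseChange (AlgebraicClosure ℚ)).toAffine.Nonsingular (aeval x A / aeval x B) y₂),
            φ (Affine.Point.some x y h) = Affine.Point.some (aeval x A / aeval x B) y₂ h₂ := by
  haveI hQbar : Algebra.IsAlgebraic ℚ (AlgebraicClosure ℚ) := AlgebraicClosure.isAlgebraic ℚ
  letI : Algebra (AlgebraicClosure ℚ) ℂ :=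
    (IsAlgClosed.lift : AlgebraicClosure ℚ →ₐ[ℚ] ℂ).toRingHom.toAlgebra
  haveI : IsScalarTower ℚ (AlgebraicClosure ℚ) ℂ :=
    IsScalarTower.of_algebraMap_eq' (Subsingleton.elim _ _)
  exact φ.exists_int_multiplier_dvd_degree_aux


end WeierstrassCurve

end
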